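import Mathlib
import Summits.ResolutionOfSingularities.ResolutionOfSingularities.Theorems.WildQuotientsWildQuotientResolutionToricExitRootChartInvariants

/-!
# Initial-form criterion for injectivity of polynomial substitutions (generic tool for the V4U root charts)

(crux stmt-ResolutionOfSingularities-15640 `WildQuotients.WildQuotientResolution`, line `Sketch`,
sector `|G| = p`; programme V4U of `L/w45c/CHAIN.md` v6 §4 row stub-1 (T1 «`twistedChart_injective`»)
— the generic half; the instance is `…JordanFourTwistedChartInjective`. [OURS · L1 W4.5c] — NOT a
statement of any manuscript; replaces the role of no printed item. Prover res-L1-w45c-stub-1.)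

For weights `w : τ → ℕ` on `R[τ]` we use LOWER BOUNDS «every monomial of `f` has `w`-weight `≥ v`»
in the explicit form `∀ d, coeff d f ≠ 0 → v ≤ weight w d` (stable under `+`, `−`, `C c ·`, products
add the bounds, powers multiply them: `lb_*`). **`aeval_injective_of_initialForms`**: let
`g, g₀ : ι → R[τ]`, `w₁ : ι → ℕ`, with `g₀ i` weighted homogeneous of degree `w₁ i` and `g i − g₀ i`
of lower bound `w₁ i + 1` (`g₀ i` = the initial form of `g i`). If `aeval g₀` is injective then so
is `aeval g` — for `F ≠ 0` with least `w₁`-weight `m` on its support, the `w`-weight-`m` component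
of `aeval g F` is `aeval g₀` of the `w₁`-weight-`m` component of `F`, which is non-zero.
-/

-- single-problem summit: the doubled namespace component `ResolutionOfSingularities` is forced
set_option linter.dupNamespace false

noncomputable section

open MvPolynomial

namespace Summit.ResolutionOfSingularities.ResolutionOfSingularities.Theorems.WildQuotientResolution.JordanFour

section InitialForm

/-! ### Generic: lower bounds on the weights of the monomials of a polynomial -/

variable {R : Type*} [CommRing R] {ι τ : Type*} (w : τ → ℕ)

/-- Lower weight bounds add under `+`. [folklore] -/
theorem lb_add {v : ℕ} {f g : MvPolynomial τ R}
    (hf : ∀ d, coeff d f ≠ 0 → v ≤ Finsupp.weight w d)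
    (hg : ∀ d, coeff d g ≠ 0 → v ≤ Finsupp.weight w d) :
    ∀ d, coeff d (f + g) ≠ 0 → v ≤ Finsupp.weight w d := by
  intro d hd
  rw [coeff_add] at hd
  by_cases hf0 : coeff d f = 0
  · rw [hf0, zero_add] at hd
    exact hg d hd
  · exact hf d hf0

/-- Lower weight bounds are stable under negation. [folklore] -/
theorem lb_neg {v : ℕ} {f : MvPolynomial τ R} (hf : ∀ d, coeff d f ≠ 0 → v ≤ Finsupp.weight w d) :
    ∀ d, coeff d (-f) ≠ 0 → v ≤ Finsupp.weight w d := by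
  intro d hd
  rw [coeff_neg, neg_ne_zero] at hd
  exact hf d hd

/-- Lower weight bounds add under `−`. [folklore] -/
theorem lb_sub {v : ℕ} {f g : MvPolynomial τ R}
    (hf : ∀ d, coeff d f ≠ 0 → v ≤ Finsupp.weight w d)
    (hg : ∀ d, coeff d g ≠ 0 → v ≤ Finsupp.weight w d) :
    ∀ d, coeff d (f - g) ≠ 0 → v ≤ Finsupp.weight w d := by
  rw [sub_eq_add_neg]
  exact lb_add w hf (lb_neg w hg)

/-- Lower weight bounds are monotone. [folklore] -/
theorem lb_mono {v v' : ℕ} (h : v' ≤ v) {f : MvPolynomial τ R}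
    (hf : ∀ d, coeff d f ≠ 0 → v ≤ Finsupp.weight w d) :
    ∀ d, coeff d f ≠ 0 → v' ≤ Finsupp.weight w d :=
  fun d hd => h.trans (hf d hd)

/-- Lower weight bounds are stable under `C c * ·`. [folklore] -/
theorem lb_C_mul {v : ℕ} (c : R) {f : MvPolynomial τ R}
    (hf : ∀ d, coeff d f ≠ 0 → v ≤ Finsupp.weight w d) :
    ∀ d, coeff d (C c * f) ≠ 0 → v ≤ Finsupp.weight w d := by
  intro d hd
  rw [coeff_C_mul] at hd
  exact hf d (right_ne_zero_of_mul hd)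

/-- **Lower weight bounds add under products.** [folklore] -/
theorem lb_mul {u v : ℕ} {f g : MvPolynomial τ R}
    (hf : ∀ d, coeff d f ≠ 0 → u ≤ Finsupp.weight w d)
    (hg : ∀ d, coeff d g ≠ 0 → v ≤ Finsupp.weight w d) :
    ∀ d, coeff d (f * g) ≠ 0 → u + v ≤ Finsupp.weight w d := by
  classical
  intro d hd
  rw [coeff_mul] at hd
  obtain ⟨x, hx, hne⟩ := Finset.exists_ne_zero_of_sum_ne_zero hd
  rw [Finset.HasAntidiagonal.mem_antidiagonal] at hx
  have h1 : coeff x.1 f ≠ 0 := left_ne_zero_of_mul hne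
  have h2 : coeff x.2 g ≠ 0 := right_ne_zero_of_mul hne
  rw [← hx, map_add]
  exact add_le_add (hf _ h1) (hg _ h2)

/-- Lower weight bounds of powers. [folklore] -/
theorem lb_pow {v : ℕ} {f : MvPolynomial τ R} (hf : ∀ d, coeff d f ≠ 0 → v ≤ Finsupp.weight w d) :
    ∀ e : ℕ, ∀ d, coeff d (f ^ e) ≠ 0 → e * v ≤ Finsupp.weight w d
  | 0 => fun d _ => by rw [zero_mul]; exact Nat.zero_le _
  | e + 1 => by
    rw [pow_succ, add_mul, one_mul]
    exact lb_mul w (lb_pow hf e) hf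

/-- A weighted homogeneous polynomial of degree `W ≥ v` has the lower bound `v`. [folklore] -/
theorem lb_of_isWeightedHomogeneous {W v : ℕ} {f : MvPolynomial τ R}
    (hf : IsWeightedHomogeneous w f W) (hv : v ≤ W) :
    ∀ d, coeff d f ≠ 0 → v ≤ Finsupp.weight w d :=
  fun _ hd => hv.trans (hf hd).ge

/-- `f * g` has the lower bound `v` as soon as `f` is weighted homogeneous of degree `≥ v`.
[folklore] -/
theorem lb_mul_of_isWeightedHomogeneous_left {W v : ℕ} {f : MvPolynomial τ R}
    (hf : IsWeightedHomogeneous w f W) (hv : v ≤ W) (g : MvPolynomial τ R) :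
    ∀ d, coeff d (f * g) ≠ 0 → v ≤ Finsupp.weight w d := by
  have h := lb_mul w (lb_of_isWeightedHomogeneous w hf hv)
    (fun d (_ : coeff d g ≠ 0) => Nat.zero_le (Finsupp.weight w d))
  rwa [add_zero] at h

/-- A component below the lower bound vanishes. [folklore] -/
theorem weightedHomogeneousComponent_eq_zero_of_lb {v m : ℕ} {f : MvPolynomial τ R}
    (hf : ∀ d, coeff d f ≠ 0 → v ≤ Finsupp.weight w d) (hm : m < v) :
    weightedHomogeneousComponent w m f = 0 := by
  refine weightedHomogeneousComponent_eq_zero' m f fun d hd h => ?_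
  have := hf d (mem_support_iff.mp hd)
  omega

/-- **`g^e − g₀^e` has only monomials of weight `> e·v`** when `g₀` is homogeneous of degree `v`
and `g − g₀` has only monomials of weight `> v`. [folklore] -/
theorem lb_pow_sub_pow {g g₀ : MvPolynomial τ R} {v : ℕ} (h₀ : IsWeightedHomogeneous w g₀ v)
    (hr : ∀ d, coeff d (g - g₀) ≠ 0 → v + 1 ≤ Finsupp.weight w d) :
    ∀ e : ℕ, ∀ d, coeff d (g ^ e - g₀ ^ e) ≠ 0 → e * v + 1 ≤ Finsupp.weight w d
  | 0 => fun d hd => by simp at hd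
  | e + 1 => by
    have hg : ∀ d, coeff d g ≠ 0 → v ≤ Finsupp.weight w d := by
      have h := lb_add w (lb_mono w (Nat.le_succ v) hr) (lb_of_isWeightedHomogeneous w h₀ le_rfl)
      rwa [sub_add_cancel] at h
    have e1 : g ^ (e + 1) - g₀ ^ (e + 1) = (g - g₀) * g ^ e + g₀ * (g ^ e - g₀ ^ e) := by ring
    rw [e1]
    refine lb_add w ?_ ?_
    · exact lb_mono w (by rw [Nat.succ_mul]; omega) (lb_mul w hr (lb_pow w hg e))
    · exact lb_mono w (by rw [Nat.succ_mul]; omega)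
        (lb_mul w (lb_of_isWeightedHomogeneous w h₀ le_rfl) (lb_pow_sub_pow h₀ hr e))

/-- **`∏ g_i − ∏ g₀_i` has only monomials of weight `> Σ v_i`** when each `g₀_i` is homogeneous
of degree `v_i` and each `g_i − g₀_i` has only monomials of weight `> v_i`. [folklore] -/
theorem lb_prod_sub_prod [DecidableEq ι] (s : Finset ι) (g g₀ : ι → MvPolynomial τ R) (v : ι → ℕ)
    (h₀ : ∀ i ∈ s, IsWeightedHomogeneous w (g₀ i) (v i))
    (hr : ∀ i ∈ s, ∀ d, coeff d (g i - g₀ i) ≠ 0 → v i + 1 ≤ Finsupp.weight w d) :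
    ∀ d, coeff d (∏ i ∈ s, g i - ∏ i ∈ s, g₀ i) ≠ 0 → (∑ i ∈ s, v i) + 1 ≤ Finsupp.weight w d := by
  induction s using Finset.induction_on with
  | empty => intro d hd; simp at hd
  | insert j s hj ih =>
    have h₀' : ∀ i ∈ s, IsWeightedHomogeneous w (g₀ i) (v i) :=
      fun i hi => h₀ i (Finset.mem_insert_of_mem hi)
    have hr' : ∀ i ∈ s, ∀ d, coeff d (g i - g₀ i) ≠ 0 → v i + 1 ≤ Finsupp.weight w d :=
      fun i hi => hr i (Finset.mem_insert_of_mem hi)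
    have ih' := ih h₀' hr'
    have hb₀ : IsWeightedHomogeneous w (∏ i ∈ s, g₀ i) (∑ i ∈ s, v i) :=
      IsWeightedHomogeneous.prod s g₀ v h₀'
    have hb : ∀ d, coeff d (∏ i ∈ s, g i) ≠ 0 → (∑ i ∈ s, v i) ≤ Finsupp.weight w d := by
      have h := lb_add w (lb_mono w (Nat.le_succ _) ih') (lb_of_isWeightedHomogeneous w hb₀ le_rfl)
      rwa [sub_add_cancel] at h
    rw [Finset.prod_insert hj, Finset.prod_insert hj, Finset.sum_insert hj]
    have e1 : g j * ∏ i ∈ s, g i - g₀ j * ∏ i ∈ s, g₀ i =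
        (g j - g₀ j) * ∏ i ∈ s, g i + g₀ j * (∏ i ∈ s, g i - ∏ i ∈ s, g₀ i) := by ring
    rw [e1]
    refine lb_add w ?_ ?_
    · exact lb_mono w (by omega) (lb_mul w (hr j (Finset.mem_insert_self j s)) hb)
    · exact lb_mono w (by omega)
        (lb_mul w (lb_of_isWeightedHomogeneous w (h₀ j (Finset.mem_insert_self j s)) le_rfl) ih')

/-- **INITIAL-FORM CRITERION FOR INJECTIVITY.** Let `g, g₀ : ι → R[τ]` with `g₀ i` weighted
homogeneous of `w₂`-degree `w₁ i` and every monomial of `g i − g₀ i` of `w₂`-weight `> w₁ i`. If the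
substitution `aeval g₀` is injective then so is `aeval g`. (The `w₂`-weight-`m` component of
`aeval g F`, `m` the least `w₁`-weight on the support of `F`, is `aeval g₀` of the `w₁`-weight-`m`
component of `F`.) [folklore] -/
theorem aeval_injective_of_initialForms (w₁ : ι → ℕ) (w₂ : τ → ℕ) (g g₀ : ι → MvPolynomial τ R)
    (h₀ : ∀ i, IsWeightedHomogeneous w₂ (g₀ i) (w₁ i))
    (hr : ∀ i d, coeff d (g i - g₀ i) ≠ 0 → w₁ i + 1 ≤ Finsupp.weight w₂ d)
    (hinj : Function.Injective (aeval g₀ : MvPolynomial ι R →ₐ[R] MvPolynomial τ R)) :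
    Function.Injective (aeval g : MvPolynomial ι R →ₐ[R] MvPolynomial τ R) := by
  classical
  -- per-monomial estimate
  have hmon : ∀ (e : ι →₀ ℕ) (c : R),
      IsWeightedHomogeneous w₂ (aeval g₀ (monomial e c)) (Finsupp.weight w₁ e) ∧
      ∀ d, coeff d (aeval g (monomial e c) - aeval g₀ (monomial e c)) ≠ 0 →
        Finsupp.weight w₁ e + 1 ≤ Finsupp.weight w₂ d := by
    intro e c
    refine ⟨ToricExit.isWeightedHomogeneous_aeval w₁ w₂ g₀ h₀ _ _
      (isWeightedHomogeneous_monomial w₁ e c rfl), ?_⟩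
    rw [aeval_monomial, aeval_monomial, ← mul_sub, MvPolynomial.algebraMap_eq, Finsupp.prod,
      Finsupp.prod]
    have hwt : Finsupp.weight w₁ e = ∑ i ∈ e.support, e i * w₁ i := by
      rw [Finsupp.weight_apply, Finsupp.sum]
      simp only [smul_eq_mul]
    rw [hwt]
    refine lb_C_mul w₂ c (lb_prod_sub_prod w₂ e.support (fun i => g i ^ e i) (fun i => g₀ i ^ e i)
      (fun i => e i * w₁ i) (fun i _ => ?_) (fun i _ => lb_pow_sub_pow w₂ (h₀ i) (hr i) (e i)))
    have h := (h₀ i).pow (e i)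
    rwa [smul_eq_mul] at h
  rw [injective_iff_map_eq_zero]
  intro F hF
  by_contra hF0
  have hsupp : F.support.Nonempty := by
    rw [Finset.nonempty_iff_ne_empty, Ne, support_eq_empty]
    exact hF0
  obtain ⟨m, hm, hmle⟩ : ∃ m : ℕ, (∃ d ∈ F.support, Finsupp.weight w₁ d = m) ∧
      ∀ d ∈ F.support, m ≤ Finsupp.weight w₁ d := by
    refine ⟨(F.support.image (Finsupp.weight w₁)).min' (hsupp.image _), ?_, fun d hd =>
      Finset.min'_le _ _ (Finset.mem_image_of_mem _ hd)⟩
    obtain ⟨d, hd, h⟩ := Finset.mem_image.mp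
      (Finset.min'_mem (F.support.image (Finsupp.weight w₁)) (hsupp.image _))
    exact ⟨d, hd, h⟩
  obtain ⟨d₀, hd₀, hd₀m⟩ := hm
  have key : weightedHomogeneousComponent w₂ m (aeval g F) =
      aeval g₀ (weightedHomogeneousComponent w₁ m F) := by
    conv_lhs => rw [F.as_sum, map_sum, map_sum]
    rw [weightedHomogeneousComponent_apply, map_sum, Finset.sum_filter]
    refine Finset.sum_congr rfl fun d hd => ?_
    obtain ⟨hA₀, hdiff⟩ := hmon d (coeff d F)
    have hsplit : aeval g (monomial d (coeff d F)) = aeval g₀ (monomial d (coeff d F)) +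
        (aeval g (monomial d (coeff d F)) - aeval g₀ (monomial d (coeff d F))) := by ring
    have hlt : m < Finsupp.weight w₁ d + 1 := Nat.lt_succ_of_le (hmle d hd)
    rw [hsplit, map_add, weightedHomogeneousComponent_eq_zero_of_lb w₂ hdiff hlt, add_zero,
      weightedHomogeneousComponent_of_mem ((mem_weightedHomogeneousSubmodule _ _ _ _).mpr hA₀)]
    by_cases h : Finsupp.weight w₁ d = m
    · rw [if_pos h, if_pos h.symm]
    · rw [if_neg h, if_neg (Ne.symm h)]
  rw [hF, map_zero] at key
  have hF₀ : weightedHomogeneousComponent w₁ m F = 0 := hinj (by rw [← key, map_zero])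
  have hc := congrArg (coeff d₀) hF₀
  rw [coeff_weightedHomogeneousComponent, if_pos hd₀m, coeff_zero] at hc
  exact (mem_support_iff.mp hd₀) hc

end InitialForm

end Summit.ResolutionOfSingularities.ResolutionOfSingularities.Theorems.WildQuotientResolution.JordanFour

end
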